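import Mathlib
import Summits.Ventures.PercRepro2.TBFavX

/-!
# The exact admissibility rule `TBAdm` — the statement of record of mine-c g19 (a named candidate)
(blind cell PercRepro2, mine-c g19, 2026-08-25; `conjectures/MINE-C.md` §28.19′)

A conjunction of single-cluster events for a vertex `v` among the four FAVOURABLE events
`v ∈ K_b`, `v ∈ M_r`, `v ∉ K_r`, `v ∉ M_b` and the two tolerated UNFAVOURABLE exclusions
`v ∉ K_b`, `v ∉ M_r` (`AdmCon`; the inclusions `v ∈ K_r`, `v ∈ M_b` are never admissible).
PER VERTEX (`AdmCon.Valid`): `∉ K_b` must be accompanied by `∈ M_r` or by `∉ K_r` (a two-colour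
`a₁`-avoidance); `∉ M_r` by `∈ K_b` or by `∉ M_b` (an `a₂`-avoidance); not both avoidance kinds on
one vertex.  GLOBALLY (`AdmSystem`): an `a₁`-avoidance (`∉ K_b` without `∈ M_r`) on any vertex
forbids `∉ M_r` on every vertex; an `a₂`-avoidance (`∉ M_r` without `∈ K_b`) forbids `∉ K_b`
everywhere.  The rule reproduces the FULL 81 × 81 census of pattern pairs with the exclusive mark
(n = 7, m ≤ 9: 744 signed pairs of 6,561, 0 mismatches) and the triple census with an avoided third
vertex (§28.19′).  The CANDIDATE `TBAdm` (one seat): for every admissible system,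

  `0 ≤ Σ_Q Π_{v ∈ S} 1[E_v holds] · (1[o ∈ M_r] − 1[o ∈ M_b])`   (`pairCount F z (admK …)`).

`TBFav_of_TBAdm`: favourable systems are admissible, so `TBAdm → TBFav → TB14` (row 2′TB);
`favKX_disjoint_of_TBAdm`: the one-root avoid sets of `TBFavX` on vertices disjoint from `S` are
the avoidance-type constraints.  Own work; standard axioms; no proof of the candidate is claimed.
-/

namespace Summit.Ventures.PercRepro2

namespace FavCond

open CovForm A3InactiveTyped TB14Cut

/-- A conjunction of single-cluster events for a vertex: the four favourable fields of `FavCon`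
and the two tolerated unfavourable exclusions (`notKb`: `v ∉ K_b`; `notMr`: `v ∉ M_r`). -/
structure AdmCon where
  inKb : Bool
  inMr : Bool
  notKr : Bool
  notMb : Bool
  notKb : Bool
  notMr : Bool

/-- An UNACCOMPANIED `∉ K_b` (no `∈ M_r` on the same vertex): the `a₁`-avoidance kind. -/
def AdmCon.UnaccKb (c : AdmCon) : Prop := c.notKb = true ∧ c.inMr = false

/-- An unaccompanied `∉ M_r` (no `∈ K_b` on the same vertex): the `a₂`-avoidance kind. -/
def AdmCon.UnaccMr (c : AdmCon) : Prop := c.notMr = true ∧ c.inKb = false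

/-- **Per-vertex validity**: an unaccompanied `∉ K_b` needs `∉ K_r`, an unaccompanied `∉ M_r` needs
`∉ M_b`, and not both kinds on one vertex. -/
def AdmCon.Valid (c : AdmCon) : Prop :=
  (c.UnaccKb → c.notKr = true) ∧ (c.UnaccMr → c.notMb = true) ∧ ¬ (c.UnaccKb ∧ c.UnaccMr)

/-- **The admissible systems**: every constraint valid, and the two avoidance kinds do not mix with
the other side's exclusion. -/
def AdmSystem {V : Type*} (S : Finset V) (c : V → AdmCon) : Prop :=
  (∀ v ∈ S, (c v).Valid) ∧
    ((∃ v ∈ S, (c v).UnaccKb) → ∀ u ∈ S, (c u).notMr = false) ∧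
    ((∃ v ∈ S, (c v).UnaccMr) → ∀ u ∈ S, (c u).notKb = false)

/-- A favourable constraint as an admissible one (no unfavourable exclusion). -/
def AdmCon.ofFav (c : FavCon) : AdmCon := ⟨c.inKb, c.inMr, c.notKr, c.notMb, false, false⟩

/-- The two-colour `a₁`-avoidance as a constraint. -/
def AdmCon.avoid₁ : AdmCon := ⟨false, false, true, false, true, false⟩

/-- The two-colour `a₂`-avoidance as a constraint. -/
def AdmCon.avoid₂ : AdmCon := ⟨false, false, false, true, false, true⟩

/-- A favourable constraint carries no `a₁`-avoidance (its `notKb` field is `false`). -/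
lemma AdmCon.not_unaccKb_ofFav (c : FavCon) : ¬ (AdmCon.ofFav c).UnaccKb := fun h => by
  simp [AdmCon.UnaccKb, AdmCon.ofFav] at h

/-- A favourable constraint carries no `a₂`-avoidance (its `notMr` field is `false`). -/
lemma AdmCon.not_unaccMr_ofFav (c : FavCon) : ¬ (AdmCon.ofFav c).UnaccMr := fun h => by
  simp [AdmCon.UnaccMr, AdmCon.ofFav] at h

/-- A favourable constraint is valid (both avoidance premises are vacuous). -/
lemma AdmCon.valid_ofFav (c : FavCon) : (AdmCon.ofFav c).Valid :=
  ⟨fun h => absurd h (AdmCon.not_unaccKb_ofFav c), fun h => absurd h (AdmCon.not_unaccMr_ofFav c),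
    fun h => AdmCon.not_unaccKb_ofFav c h.1⟩

/-- The two-colour `a₁`-avoidance is valid (`∉ K_b` is accompanied by `∉ K_r`). -/
lemma AdmCon.valid_avoid₁ : AdmCon.avoid₁.Valid :=
  ⟨fun _ => rfl, fun h => by simp [AdmCon.UnaccMr, AdmCon.avoid₁] at h,
    fun h => by simp [AdmCon.UnaccMr, AdmCon.avoid₁] at h⟩

/-- The two-colour `a₂`-avoidance is valid (`∉ M_r` is accompanied by `∉ M_b`). -/
lemma AdmCon.valid_avoid₂ : AdmCon.avoid₂.Valid :=
  ⟨fun h => by simp [AdmCon.UnaccKb, AdmCon.avoid₂] at h, fun _ => rfl,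
    fun h => by simp [AdmCon.UnaccKb, AdmCon.avoid₂] at h⟩

/-- A favourable system is admissible. -/
lemma admSystem_ofFav {V : Type*} (S : Finset V) (c : V → FavCon) :
    AdmSystem S (fun v => AdmCon.ofFav (c v)) :=
  ⟨fun v _ => AdmCon.valid_ofFav (c v),
    fun ⟨v, _, hv⟩ => absurd hv (AdmCon.not_unaccKb_ofFav (c v)),
    fun ⟨v, _, hv⟩ => absurd hv (AdmCon.not_unaccMr_ofFav (c v))⟩

section KernelAdm

variable {V : Type*} {E : Type*} {R : Type*} [Field R]

/-- The indicator of the conjunction `c` at the vertex `v` on the copy pair `(y, w)` (copy `y`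
red, copy `w` blue): the favourable factors of `favInd` times the two tolerated exclusions. -/
noncomputable def admInd (ends : E → Sym2 V) (a₁ a₂ : V) (c : AdmCon) (v : V) :
    Config E → Config E → R :=
  fun y w =>
    (if c.inKb then iL ends a₁ v w else 1) * (if c.inMr then iH ends a₂ v y else 1) *
      (if c.notKr then 1 - iL ends a₁ v y else 1) * (if c.notMb then 1 - iH ends a₂ v w else 1) *
      (if c.notKb then 1 - iL ends a₁ v w else 1) * (if c.notMr then 1 - iH ends a₂ v y else 1)

/-- The admissible kernel:
`1_Q(y) 1_Q(w) · Π_{v ∈ S} admInd (c v) v · (1[o ∈ C_y(a₂)] − 1[o ∈ C_w(a₂)])`. -/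
noncomputable def admK (ends : E → Sym2 V) (a₁ a₂ o : V) (S : Finset V) (c : V → AdmCon) :
    Config E → Config E → R :=
  fun y w => iQ ends a₁ a₂ y * iQ ends a₁ a₂ w * (∏ v ∈ S, admInd ends a₁ a₂ (c v) v y w) *
    (iH ends a₂ o y - iH ends a₂ o w)

/-- On a favourable constraint the admissible indicator is the favourable one. -/
lemma admInd_ofFav (ends : E → Sym2 V) (a₁ a₂ : V) (c : FavCon) (v : V) (y w : Config E) :
    (admInd ends a₁ a₂ (AdmCon.ofFav c) v y w : R) = favInd ends a₁ a₂ c v y w := by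
  simp only [admInd, favInd, AdmCon.ofFav, Bool.false_eq_true, ↓reduceIte, mul_one]
  ring

/-- On favourable constraints the admissible kernel is `favK`. -/
lemma admK_ofFav (ends : E → Sym2 V) (a₁ a₂ o : V) (S : Finset V) (c : V → FavCon)
    (y w : Config E) :
    (admK ends a₁ a₂ o S (fun v => AdmCon.ofFav (c v)) y w : R) = favK ends a₁ a₂ o S c y w := by
  have hp : (∏ v ∈ S, admInd ends a₁ a₂ (AdmCon.ofFav (c v)) v y w : R) =
      ∏ v ∈ S, favInd ends a₁ a₂ (c v) v y w :=
    Finset.prod_congr rfl (fun v _ => admInd_ofFav (R := R) ends a₁ a₂ (c v) v y w)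
  simp only [admK, favK, hp]

/-- The `a₁`-avoidance constraint is the two-colour avoidance factor of `avoidInd` at `a₁`
(`1[v ∈ C_y(a₁)]` is `iL`, `1[v ∈ C_w(a₁)]` is `iL` on the second copy; `iH` and `iL` are the
same indicator, `connEvent`, under two names). -/
lemma admInd_avoid₁ (ends : E → Sym2 V) (a₁ a₂ v : V) (y w : Config E) :
    (admInd ends a₁ a₂ AdmCon.avoid₁ v y w : R) = (1 - iH ends a₁ v y) * (1 - iH ends a₁ v w) := by
  simp only [admInd, AdmCon.avoid₁, Bool.false_eq_true, ↓reduceIte, mul_one, one_mul, iL, iH]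

/-- The `a₂`-avoidance constraint is the two-colour avoidance factor of `avoidInd` at `a₂`. -/
lemma admInd_avoid₂ (ends : E → Sym2 V) (a₁ a₂ v : V) (y w : Config E) :
    (admInd ends a₁ a₂ AdmCon.avoid₂ v y w : R) = (1 - iH ends a₂ v y) * (1 - iH ends a₂ v w) := by
  simp only [admInd, AdmCon.avoid₂, Bool.false_eq_true, ↓reduceIte, mul_one, one_mul]
  ring

end KernelAdm

/-- **(TB-ADM′), the exact admissibility rule** (a Prop; NOT a theorem): every admissible system of
conjunctions on a finite set of vertices, at every profile and every finite graph. -/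
def TBAdm (R : Type*) [Field R] [LinearOrder R] : Prop :=
  ∀ (V E : Type) [Fintype V] [DecidableEq V] [Fintype E] [DecidableEq E] (ends : E → Sym2 V)
    (a₁ a₂ o : V) (S : Finset V) (c : V → AdmCon) (F : Finset E) (z : Config E),
    AdmSystem S c → 0 ≤ pairCount F z (admK ends a₁ a₂ o S c : Config E → Config E → R)

section ReductionAdm

variable {R : Type*} [Field R] [LinearOrder R]

/-- **`TBFav` is the favourable case of `TBAdm`.** -/
theorem TBFav_of_TBAdm (h : TBAdm R) : TBFav R := by
  intro V E _ _ _ _ ends a₁ a₂ o S c F z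
  have h1 := h V E ends a₁ a₂ o S (fun v => AdmCon.ofFav (c v)) F z (admSystem_ofFav S c)
  have : pairCount F z (admK ends a₁ a₂ o S (fun v => AdmCon.ofFav (c v)) :
      Config E → Config E → R) = pairCount F z (favK ends a₁ a₂ o S c) := by
    congr 1
    funext y w
    exact admK_ofFav ends a₁ a₂ o S c y w
  rw [this] at h1
  exact h1

/-- **Row 2′TB is a case of `TBAdm`.** -/
theorem TB14_of_TBAdm [IsStrictOrderedRing R] (h : TBAdm R) : TB14 R :=
  TB14_of_TBFav (TBFav_of_TBAdm h)

end ReductionAdm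

end FavCond

end Summit.Ventures.PercRepro2
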